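import Literature.MathematicalPhysics.QuantumLattice.GrassmannSupportSplit
import Literature.MathematicalPhysics.QuantumLattice.GrassmannLinearSubstitution
import Literature.MathematicalPhysics.QuantumLattice.GrassmannChargeScaling
import Literature.MathematicalPhysics.QuantumLattice.GrassmannSpectatorReadout
import HarnessLib

/-!
# Spectator truncation: the outputs of a Gaussian step with at most `k` spectator legs see only the part of the vertex with at most `k`
# spectator legs (dead variables: the covariance has no line at a spectator)

Topic `MathematicalPhysics/QuantumLattice`; continuation of `GrassmannSpectatorReadout` / `GrassmannLinearSubstitution` («dead variables»,
`effAction_map_mulLeft_of_covariance`) and `GrassmannSupportSplit`.  Labels `Γ ⊕ ρ`: `Γ` the fluctuating fields, `ρ` the SPECTATORS; a covariance `C′` with no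
line at a spectator (`C′ X Y = 0` unless both labels are `inl`; e.g. `fromBlocks C 0 0 0`).  Since the Gaussian integral does not touch the spectator
generators `θ_b`, the `θ`-content of a monomial is preserved multiplicatively (`θ_b² = 0`): the kernels of `effAction C′ V` (and of `μ_{C′} ⋆ V`, `Δ_{C′}V`) at
strings with at most `k` spectator legs depend only on the kernels of `V` at strings with at most `k` spectator legs — BGM 2006 §2.3/(2.17): an
`n_e`-legged output of the tree expansion is assembled from vertices whose EXTERNAL legs number at most `n_e` in total.  So the bound of a two-plain-leg
read-out (`GrassmannSpectatorReadout` with every plain label a spectator) may be run on the TRUNCATED vertex `V♭_k` (kernels of `V` on strings with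
`≤ k` spectator legs, `0` elsewhere), whose anchored norms are the «mixed norms with at most `k` plain legs» — with the ABSTRACT cluster/Gram bounds
(`sum_[wt_]norm_kernel_effAction_sub_gaussConv_le…`), no support-aware variant needed.

* `kernel_presentedIf` — kernels of `Σ_m presented [Q]·kernel F m` for a permutation-invariant string predicate `Q`;
* `card_filter_isRight_comp_perm` — the number of spectator legs of a string is permutation invariant;
* **`kernel_spectatorTrunc`** — `kernel V♭_k m Z = [#{i : Z i ∈ inr} ≤ k] · kernel V m Z`, `V♭_k := Σ_m presented (Z ↦ [#spect Z ≤ k]·kernel V m Z)`;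
* `spectatorIndicator` facts: `mul_covariance_of_noSpectatorLine` (`c X c Y C′ X Y = C′ X Y` for the indicator `c` of `inl Γ ∪ inr T`),
  `prod_spectatorIndicator_eq_one` (a string whose spectators lie in `T`);
* **`map_mulLeft_spectatorTrunc_eq`** — `S_c V♭_k = S_c V` for the indicator `c` of `inl Γ ∪ inr T`, `|T| ≤ k` (strings with more than `k` spectator legs in `T`
  repeat a label);
* **`kernel_effAction_eq_kernel_effAction_spectatorTrunc`**, `kernel_gaussConv_eq_…`, `kernel_grassmannLaplacian_eq_…` — for every string `Z` with at most `k`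
  spectator legs: `kernel_m (effAction C′ V) Z = kernel_m (effAction C′ V♭_k) Z` (etc.), and the three-piece forms.

Everything is proved; no definition, no named fact.

## Sources
G. Benfatto, A. Giuliani, V. Mastropietro, Ann. Henri Poincaré 7 (2006) 809–898, §2.2 (2.12)–(2.14), §2.3 (2.17) [`BenfattoGiulianiMastropietro2006`];
M. Salmhofer, *Renormalization: An Introduction* (Springer 1999), App. B.2 (B.23)–(B.25), §4.3 (4.95) [`Salmhofer1999`].
-/

noncomputable section

namespace Literature.MathematicalPhysics.QuantumLattice

open GrassmannAlgebra Finset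

section Trunc

variable (R : Type*) [CommRing R] [Algebra ℚ R] {Γ ρ : Type*} [Fintype Γ] [DecidableEq Γ] [Fintype ρ] [DecidableEq ρ]

/-! ### Presented sums with a permutation-invariant string predicate -/

/-- **Kernels of a predicate-truncated kernel expansion**: for a decidable string predicate `Q` invariant under permutations of the slots,
`kernel (Σ_{m ≤ |Λ|} presented (X ↦ [Q X]·kernel F m X)) m X = [Q X]·kernel F m X`. [cite: Salmhofer1999, §4.3 (4.95)] -/
theorem kernel_presentedIf {Λ : Type*} [Fintype Λ] [DecidableEq Λ] (Q : ∀ {m : ℕ}, (Fin m → Λ) → Prop) [∀ m (X : Fin m → Λ), Decidable (Q X)]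
    (hQ : ∀ {m : ℕ} (X : Fin m → Λ) (σ : Equiv.Perm (Fin m)), Q (X ∘ σ) ↔ Q X) (F : GrassmannAlgebra R Λ) (m : ℕ) (X : Fin m → Λ) :
    kernel R (∑ m' ∈ range (Fintype.card Λ + 1), presented R (fun Y : Fin m' → Λ => if Q Y then kernel R F m' Y else 0)) m X =
      if Q X then kernel R F m X else 0 := by
  rw [kernel_sum]
  by_cases hm : m ∈ range (Fintype.card Λ + 1)
  · rw [sum_eq_single_of_mem m hm (fun k _ hk => kernel_presented_of_ne R _ X (Ne.symm hk)), kernel_presented]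
    have hc : ((m.factorial : ℚ)⁻¹ • (1 : R)) * ((m.factorial : ℕ) : R) = 1 := by
      rw [← mul_one ((m.factorial : ℕ) : R), ← nsmul_eq_mul, ← Nat.cast_smul_eq_nsmul ℚ, smul_mul_smul_comm,
        one_mul, inv_mul_cancel₀ (by positivity), one_smul]
    have hσ : ∀ σ : Equiv.Perm (Fin m), Equiv.Perm.sign σ • (fun Y : Fin m → Λ => if Q Y then kernel R F m Y else 0) (X ∘ σ) =
        if Q X then kernel R F m X else 0 := by
      intro σ
      by_cases h : Q X
      · have h' : Q (X ∘ σ) := (hQ X σ).2 h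
        simp only [if_pos h', if_pos h]
        rw [kernel_comp_perm R F m X σ, Units.smul_def, zsmul_eq_mul, ← mul_assoc, ← Int.cast_mul, Int.units_coe_mul_self, Int.cast_one,
          one_mul]
      · have h' : ¬ Q (X ∘ σ) := fun h'' => h ((hQ X σ).1 h'')
        simp only [if_neg h', if_neg h, smul_zero]
    rw [sum_congr rfl fun σ _ => hσ σ, sum_const, card_univ, Fintype.card_perm, Fintype.card_fin, nsmul_eq_mul, ← mul_assoc, hc, one_mul]
  · have hlt : Fintype.card Λ < m := by rw [mem_range] at hm; omega
    rw [sum_eq_zero fun k hk => kernel_presented_of_ne R _ X (by rintro rfl; exact hm hk), kernel_eq_zero_of_card_lt R F hlt, ite_self]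

/-! ### The number of spectator legs of a string -/

omit [Fintype Γ] [DecidableEq Γ] [Fintype ρ] [DecidableEq ρ] in
/-- The number of spectator legs does not change under a permutation of the slots. [cite: BenfattoGiulianiMastropietro2006, §2.3 (2.17)] -/
theorem card_filter_isRight_comp_perm {m : ℕ} (Z : Fin m → Γ ⊕ ρ) (σ : Equiv.Perm (Fin m)) :
    ((univ : Finset (Fin m)).filter (fun i => ((Z ∘ σ) i).isRight)).card = ((univ : Finset (Fin m)).filter (fun i => (Z i).isRight)).card := by
  rw [Finset.card_filter, Finset.card_filter]
  exact Equiv.sum_comp σ (fun i => if (Z i).isRight then 1 else 0)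

/-- **THE KERNELS OF THE SPECTATOR TRUNCATION** `V♭_k := Σ_m presented (Z ↦ [#{i : Z i ∈ inr} ≤ k]·kernel V m Z)`:
`kernel V♭_k m Z = [#spectator legs of Z ≤ k]·kernel V m Z`. [cite: BenfattoGiulianiMastropietro2006, §2.3 (2.17)] -/
theorem kernel_spectatorTrunc (k : ℕ) (V : GrassmannAlgebra R (Γ ⊕ ρ)) (m : ℕ) (Z : Fin m → Γ ⊕ ρ) :
    kernel R (∑ m' ∈ range (Fintype.card (Γ ⊕ ρ) + 1), presented R (fun Y : Fin m' → Γ ⊕ ρ =>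
        if ((univ : Finset (Fin m')).filter (fun i => (Y i).isRight)).card ≤ k then kernel R V m' Y else 0)) m Z =
      if ((univ : Finset (Fin m)).filter (fun i => (Z i).isRight)).card ≤ k then kernel R V m Z else 0 :=
  kernel_presentedIf R (Q := fun {m'} (Y : Fin m' → Γ ⊕ ρ) => ((univ : Finset (Fin m')).filter (fun i => (Y i).isRight)).card ≤ k)
    (fun Y σ => by rw [card_filter_isRight_comp_perm]) V m Z

/-! ### The indicator of `inl Γ ∪ inr T` is a dead-variable rescaling -/

omit [Fintype Γ] [DecidableEq Γ] [Fintype ρ] [Algebra ℚ R] in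
/-- **No line at a spectator**: if `C′ X Y = 0` unless both labels are `inl`, then `c X · c Y · C′ X Y = C′ X Y` for the indicator `c` of `inl Γ ∪ inr T`.
[cite: Salmhofer1999, App. B.2 (B.23)-(B.25)] -/
theorem mul_covariance_of_noSpectatorLine (C' : Matrix (Γ ⊕ ρ) (Γ ⊕ ρ) R) (hC' : ∀ X Y, C' X Y ≠ 0 → X.isLeft ∧ Y.isLeft) (T : Finset ρ)
    (X Y : Γ ⊕ ρ) :
    Sum.elim (fun _ => (1 : R)) (fun b => if b ∈ T then (1 : R) else 0) X * Sum.elim (fun _ => (1 : R)) (fun b => if b ∈ T then (1 : R) else 0) Y *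
        C' X Y = C' X Y := by
  by_cases h0 : C' X Y = 0
  · rw [h0, mul_zero]
  · obtain ⟨hX, hY⟩ := hC' X Y h0
    rcases X with X | a
    · rcases Y with Y | b
      · simp
      · simp at hY
    · simp at hX

omit [Fintype Γ] [DecidableEq Γ] [Fintype ρ] [Algebra ℚ R] in
/-- A string all of whose spectator legs lie in `T` has indicator product `1`. [cite: Salmhofer1999, App. B.2 (B.23)-(B.25)] -/
theorem prod_spectatorIndicator_eq_one (T : Finset ρ) {m : ℕ} (Z : Fin m → Γ ⊕ ρ) (hZ : ∀ i b, Z i = Sum.inr b → b ∈ T) :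
    ∏ i, Sum.elim (fun _ => (1 : R)) (fun b => if b ∈ T then (1 : R) else 0) (Z i) = 1 := by
  refine prod_eq_one fun i _ => ?_
  rcases hZi : Z i with X | b
  · rfl
  · simp [hZ i b hZi]

omit [Fintype Γ] [DecidableEq Γ] [Fintype ρ] [Algebra ℚ R] in
/-- If some spectator leg of the string lies outside `T`, the indicator product vanishes. [cite: Salmhofer1999, App. B.2 (B.23)-(B.25)] -/
theorem prod_spectatorIndicator_eq_zero (T : Finset ρ) {m : ℕ} (Z : Fin m → Γ ⊕ ρ) {i : Fin m} {b : ρ} (hZi : Z i = Sum.inr b) (hb : b ∉ T) :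
    ∏ i, Sum.elim (fun _ => (1 : R)) (fun b => if b ∈ T then (1 : R) else 0) (Z i) = 0 :=
  prod_eq_zero (mem_univ i) (by rw [hZi]; simp [hb])

omit [Fintype Γ] [DecidableEq Γ] [Fintype ρ] [DecidableEq ρ] [Algebra ℚ R] in
/-- **Pigeonhole**: a string with more than `|T|` spectator legs, all in `T`, is not injective. [cite: BenfattoGiulianiMastropietro2006, §2.3 (2.17)] -/
theorem not_injective_of_card_filter_isRight_gt (T : Finset ρ) {m : ℕ} (Z : Fin m → Γ ⊕ ρ) (hZ : ∀ i b, Z i = Sum.inr b → b ∈ T)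
    (hk : T.card < ((univ : Finset (Fin m)).filter (fun i => (Z i).isRight)).card) : ¬ Function.Injective Z := by
  classical
  intro hinj
  -- the spectator legs inject into `T`
  set I := (univ : Finset (Fin m)).filter (fun i => (Z i).isRight) with hI
  have hmem : ∀ i ∈ I, ∃ b ∈ T, Z i = Sum.inr b := by
    intro i hi
    rw [hI, mem_filter] at hi
    obtain ⟨b, hb⟩ := Sum.isRight_iff.1 hi.2
    exact ⟨b, hZ i b hb, hb⟩
  have hsub : I.image Z ⊆ T.image Sum.inr := by
    intro x hx
    obtain ⟨i, hi, rfl⟩ := mem_image.1 hx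
    obtain ⟨b, hbT, hb⟩ := hmem i hi
    rw [hb]
    exact mem_image_of_mem _ hbT
  have hcard : I.card ≤ T.card :=
    calc I.card = (I.image Z).card := (card_image_of_injective I hinj).symm
      _ ≤ (T.image Sum.inr).card := card_le_card hsub
      _ ≤ T.card := card_image_le
  exact absurd hk (not_lt.2 hcard)

/-! ### The truncation is invisible after killing the spectators outside a small set -/

/-- **`S_c V♭_k = S_c V`** for the indicator `c` of `inl Γ ∪ inr T` with `|T| ≤ k`: a string surviving `S_c` has all its spectator legs in `T`; if it has more
than `k ≥ |T|` of them it repeats a label and both kernels vanish, otherwise the truncation does not touch it. [cite: BenfattoGiulianiMastropietro2006, §2.3 (2.17)] -/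
theorem map_mulLeft_spectatorTrunc_eq (k : ℕ) (T : Finset ρ) (hT : T.card ≤ k) (V : GrassmannAlgebra R (Γ ⊕ ρ)) :
    ExteriorAlgebra.map (LinearMap.mulLeft R (Sum.elim (fun _ => (1 : R)) (fun b => if b ∈ T then (1 : R) else 0)))
        (∑ m' ∈ range (Fintype.card (Γ ⊕ ρ) + 1), presented R (fun Y : Fin m' → Γ ⊕ ρ =>
          if ((univ : Finset (Fin m')).filter (fun i => (Y i).isRight)).card ≤ k then kernel R V m' Y else 0)) =
      ExteriorAlgebra.map (LinearMap.mulLeft R (Sum.elim (fun _ => (1 : R)) (fun b => if b ∈ T then (1 : R) else 0))) V := by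
  set A := ExteriorAlgebra.map (LinearMap.mulLeft R (Sum.elim (fun _ => (1 : R)) (fun b => if b ∈ T then (1 : R) else 0)))
        (∑ m' ∈ range (Fintype.card (Γ ⊕ ρ) + 1), presented R (fun Y : Fin m' → Γ ⊕ ρ =>
          if ((univ : Finset (Fin m')).filter (fun i => (Y i).isRight)).card ≤ k then kernel R V m' Y else 0)) with hA
  set B := ExteriorAlgebra.map (LinearMap.mulLeft R (Sum.elim (fun _ => (1 : R)) (fun b => if b ∈ T then (1 : R) else 0))) V with hB
  have hk : ∀ (m : ℕ) (Z : Fin m → Γ ⊕ ρ), kernel R A m Z = kernel R B m Z := by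
    intro m Z
    rw [hA, hB, kernel_map_mulLeft, kernel_map_mulLeft, kernel_spectatorTrunc]
    by_cases hout : ∃ i b, Z i = Sum.inr b ∧ b ∉ T
    · obtain ⟨i, b, hZi, hb⟩ := hout
      rw [prod_spectatorIndicator_eq_zero R T Z hZi hb, zero_mul, zero_mul]
    · push Not at hout
      split_ifs with hle
      · rfl
      · rw [kernel_eq_zero_of_not_injective R V (not_injective_of_card_filter_isRight_gt T Z hout (by omega)), mul_zero]
  calc A = ∑ m ∈ range (Fintype.card (Γ ⊕ ρ) + 1), presented R (kernel R A m) := eq_sum_presented_kernel R A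
    _ = ∑ m ∈ range (Fintype.card (Γ ⊕ ρ) + 1), presented R (kernel R B m) := by
        refine sum_congr rfl fun m _ => ?_
        congr 1
        funext Z
        exact hk m Z
    _ = B := (eq_sum_presented_kernel R B).symm

omit [Fintype Γ] in
/-- The set of spectator VALUES of a string, and its two properties: every spectator leg takes a value in it, and it has at most as many elements as the
string has spectator legs. [cite: BenfattoGiulianiMastropietro2006, §2.3 (2.17)] -/
theorem spectatorValues_spec {m : ℕ} (Z : Fin m → Γ ⊕ ρ) :
    (∀ i b, Z i = Sum.inr b → b ∈ (univ : Finset ρ).filter (fun b => Sum.inr b ∈ (univ : Finset (Fin m)).image Z)) ∧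
      ((univ : Finset ρ).filter (fun b => Sum.inr b ∈ (univ : Finset (Fin m)).image Z)).card ≤
        ((univ : Finset (Fin m)).filter (fun i => (Z i).isRight)).card := by
  refine ⟨fun i b hb => mem_filter.2 ⟨mem_univ _, mem_image.2 ⟨i, mem_univ _, hb⟩⟩, ?_⟩
  set T := (univ : Finset ρ).filter (fun b => Sum.inr b ∈ (univ : Finset (Fin m)).image Z) with hT
  have hsub : T.image Sum.inr ⊆ ((univ : Finset (Fin m)).filter (fun i => (Z i).isRight)).image Z := by
    intro x hx
    obtain ⟨b, hb, rfl⟩ := mem_image.1 hx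
    obtain ⟨i, -, hi⟩ := mem_image.1 (mem_filter.1 hb).2
    exact mem_image.2 ⟨i, mem_filter.2 ⟨mem_univ _, by rw [hi]; rfl⟩, hi⟩
  calc T.card = (T.image Sum.inr).card := (card_image_of_injective T Sum.inr_injective).symm
    _ ≤ (((univ : Finset (Fin m)).filter (fun i => (Z i).isRight)).image Z).card := card_le_card hsub
    _ ≤ _ := card_image_le

/-- **THE OUTPUT KERNELS WITH AT MOST `k` SPECTATOR LEGS SEE ONLY THE TRUNCATED VERTEX**: if `C′` has no line at a spectator, then for every string `Z`
with at most `k` spectator legs, `kernel_m (effAction C′ V) Z = kernel_m (effAction C′ V♭_k) Z`. [cite: BenfattoGiulianiMastropietro2006, §2.3 (2.17)] -/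
theorem kernel_effAction_eq_kernel_effAction_spectatorTrunc (C' : Matrix (Γ ⊕ ρ) (Γ ⊕ ρ) R) (hC' : ∀ X Y, C' X Y ≠ 0 → X.isLeft ∧ Y.isLeft)
    (k : ℕ) (V : GrassmannAlgebra R (Γ ⊕ ρ)) (m : ℕ) (Z : Fin m → Γ ⊕ ρ) (hZ : ((univ : Finset (Fin m)).filter (fun i => (Z i).isRight)).card ≤ k) :
    kernel R (effAction R C' V) m Z =
      kernel R (effAction R C' (∑ m' ∈ range (Fintype.card (Γ ⊕ ρ) + 1), presented R (fun Y : Fin m' → Γ ⊕ ρ =>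
        if ((univ : Finset (Fin m')).filter (fun i => (Y i).isRight)).card ≤ k then kernel R V m' Y else 0))) m Z := by
  obtain ⟨hZT, hTcard⟩ := spectatorValues_spec (Γ := Γ) Z
  set T := (univ : Finset ρ).filter (fun b => Sum.inr b ∈ (univ : Finset (Fin m)).image Z) with hT
  set c : Γ ⊕ ρ → R := Sum.elim (fun _ => (1 : R)) (fun b => if b ∈ T then (1 : R) else 0) with hc
  have hcov : ∀ X Y, c X * c Y * C' X Y = C' X Y := mul_covariance_of_noSpectatorLine R C' hC' T
  have hone : ∏ i, c (Z i) = 1 := prod_spectatorIndicator_eq_one R T Z hZT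
  have key := map_mulLeft_spectatorTrunc_eq R k T (hTcard.trans hZ) V
  have h1 : ∀ W : GrassmannAlgebra R (Γ ⊕ ρ), kernel R (effAction R C' W) m Z =
      kernel R (effAction R C' (ExteriorAlgebra.map (LinearMap.mulLeft R c) W)) m Z := by
    intro W
    rw [effAction_map_mulLeft_of_covariance R c hcov, kernel_map_mulLeft, hone, one_mul]
  rw [h1 V, ← key]
  exact (h1 _).symm

/-- The same for the Gaussian convolution: `kernel_m (μ_{C′} ⋆ V) Z = kernel_m (μ_{C′} ⋆ V♭_k) Z`. [cite: BenfattoGiulianiMastropietro2006, §2.2 (2.12)] -/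
theorem kernel_gaussConv_eq_kernel_gaussConv_spectatorTrunc (C' : Matrix (Γ ⊕ ρ) (Γ ⊕ ρ) R) (hC' : ∀ X Y, C' X Y ≠ 0 → X.isLeft ∧ Y.isLeft)
    (k : ℕ) (V : GrassmannAlgebra R (Γ ⊕ ρ)) (m : ℕ) (Z : Fin m → Γ ⊕ ρ) (hZ : ((univ : Finset (Fin m)).filter (fun i => (Z i).isRight)).card ≤ k) :
    kernel R (gaussConv R C' V) m Z =
      kernel R (gaussConv R C' (∑ m' ∈ range (Fintype.card (Γ ⊕ ρ) + 1), presented R (fun Y : Fin m' → Γ ⊕ ρ =>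
        if ((univ : Finset (Fin m')).filter (fun i => (Y i).isRight)).card ≤ k then kernel R V m' Y else 0))) m Z := by
  obtain ⟨hZT, hTcard⟩ := spectatorValues_spec (Γ := Γ) Z
  set T := (univ : Finset ρ).filter (fun b => Sum.inr b ∈ (univ : Finset (Fin m)).image Z) with hT
  set c : Γ ⊕ ρ → R := Sum.elim (fun _ => (1 : R)) (fun b => if b ∈ T then (1 : R) else 0) with hc
  have hcov : (Matrix.of fun X Y => c X * c Y * C' X Y) = C' := Matrix.ext fun X Y => mul_covariance_of_noSpectatorLine R C' hC' T X Y
  have hone : ∏ i, c (Z i) = 1 := prod_spectatorIndicator_eq_one R T Z hZT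
  have key := map_mulLeft_spectatorTrunc_eq R k T (hTcard.trans hZ) V
  have h1 : ∀ W : GrassmannAlgebra R (Γ ⊕ ρ), kernel R (gaussConv R C' W) m Z =
      kernel R (gaussConv R C' (ExteriorAlgebra.map (LinearMap.mulLeft R c) W)) m Z := by
    intro W
    rw [gaussConv_map_mulLeft, hcov, kernel_map_mulLeft, hone, one_mul]
  rw [h1 V, ← key]
  exact (h1 _).symm

/-- The same for the Laplacian (the one-line piece): `kernel_m (Δ_{C′} V) Z = kernel_m (Δ_{C′} V♭_k) Z`. [cite: BenfattoGiulianiMastropietro2006, §2.2 (2.12)] -/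
theorem kernel_grassmannLaplacian_eq_kernel_grassmannLaplacian_spectatorTrunc (C' : Matrix (Γ ⊕ ρ) (Γ ⊕ ρ) R)
    (hC' : ∀ X Y, C' X Y ≠ 0 → X.isLeft ∧ Y.isLeft) (k : ℕ) (V : GrassmannAlgebra R (Γ ⊕ ρ)) (m : ℕ) (Z : Fin m → Γ ⊕ ρ)
    (hZ : ((univ : Finset (Fin m)).filter (fun i => (Z i).isRight)).card ≤ k) :
    kernel R (grassmannLaplacian R C' V) m Z =
      kernel R (grassmannLaplacian R C' (∑ m' ∈ range (Fintype.card (Γ ⊕ ρ) + 1), presented R (fun Y : Fin m' → Γ ⊕ ρ =>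
        if ((univ : Finset (Fin m')).filter (fun i => (Y i).isRight)).card ≤ k then kernel R V m' Y else 0))) m Z := by
  obtain ⟨hZT, hTcard⟩ := spectatorValues_spec (Γ := Γ) Z
  set T := (univ : Finset ρ).filter (fun b => Sum.inr b ∈ (univ : Finset (Fin m)).image Z) with hT
  set c : Γ ⊕ ρ → R := Sum.elim (fun _ => (1 : R)) (fun b => if b ∈ T then (1 : R) else 0) with hc
  have hcov : (Matrix.of fun X Y => c X * c Y * C' X Y) = C' := Matrix.ext fun X Y => mul_covariance_of_noSpectatorLine R C' hC' T X Y
  have hone : ∏ i, c (Z i) = 1 := prod_spectatorIndicator_eq_one R T Z hZT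
  have key := map_mulLeft_spectatorTrunc_eq R k T (hTcard.trans hZ) V
  have h1 : ∀ W : GrassmannAlgebra R (Γ ⊕ ρ), kernel R (grassmannLaplacian R C' W) m Z =
      kernel R (grassmannLaplacian R C' (ExteriorAlgebra.map (LinearMap.mulLeft R c) W)) m Z := by
    intro W
    rw [grassmannLaplacian_map_mulLeft, hcov, kernel_map_mulLeft, hone, one_mul]
  rw [h1 V, ← key]
  exact (h1 _).symm

/-- The input itself at such strings: `kernel_m V Z = kernel_m V♭_k Z`. [cite: BenfattoGiulianiMastropietro2006, §2.3 (2.17)] -/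
theorem kernel_eq_kernel_spectatorTrunc (k : ℕ) (V : GrassmannAlgebra R (Γ ⊕ ρ)) (m : ℕ) (Z : Fin m → Γ ⊕ ρ)
    (hZ : ((univ : Finset (Fin m)).filter (fun i => (Z i).isRight)).card ≤ k) :
    kernel R V m Z = kernel R (∑ m' ∈ range (Fintype.card (Γ ⊕ ρ) + 1), presented R (fun Y : Fin m' → Γ ⊕ ρ =>
        if ((univ : Finset (Fin m')).filter (fun i => (Y i).isRight)).card ≤ k then kernel R V m' Y else 0)) m Z := by
  rw [kernel_spectatorTrunc, if_pos hZ]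

omit [Algebra ℚ R] [Fintype Γ] [DecidableEq Γ] [Fintype ρ] [DecidableEq ρ] in
/-- `fromBlocks C 0 0 0` has no line at a spectator. [cite: BenfattoGiulianiMastropietro2006, §2.2 (2.12)] -/
theorem noSpectatorLine_fromBlocks_zero (C : Matrix Γ Γ R) (X Y : Γ ⊕ ρ)
    (h : (Matrix.fromBlocks C (0 : Matrix Γ ρ R) (0 : Matrix ρ Γ R) (0 : Matrix ρ ρ R)) X Y ≠ 0) : X.isLeft ∧ Y.isLeft := by
  rcases X with X | a
  · rcases Y with Y | b
    · exact ⟨rfl, rfl⟩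
    · exact absurd rfl h
  · rcases Y with Y | b
    · exact absurd rfl h
    · exact absurd rfl h

end Trunc

/-! ### The anchored norms of the truncation are the mixed norms with at most `k` spectator legs -/

section Norms

variable {𝕜 : Type*} [RCLike 𝕜] {Γ ρ : Type*} [Fintype Γ] [DecidableEq Γ] [Fintype ρ] [DecidableEq ρ]

/-- **Weighted sums of norms of the truncation's kernels** run over the strings with at most `k` spectator legs only:
`Σ_{Z ∈ s} w Z·‖kernel V♭_k m Z‖ = Σ_{Z ∈ s, #spect Z ≤ k} w Z·‖kernel V m Z‖`. [cite: BenfattoGiulianiMastropietro2006, §2.3 (2.17)] -/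
theorem sum_mul_norm_kernel_spectatorTrunc (k : ℕ) (V : GrassmannAlgebra 𝕜 (Γ ⊕ ρ)) (m : ℕ) (s : Finset (Fin m → Γ ⊕ ρ))
    (w : (Fin m → Γ ⊕ ρ) → ℝ) :
    ∑ Z ∈ s, w Z * ‖kernel 𝕜 (∑ m' ∈ range (Fintype.card (Γ ⊕ ρ) + 1), presented 𝕜 (fun Y : Fin m' → Γ ⊕ ρ =>
        if ((univ : Finset (Fin m')).filter (fun i => (Y i).isRight)).card ≤ k then kernel 𝕜 V m' Y else 0)) m Z‖ =
      ∑ Z ∈ s.filter (fun Z => ((univ : Finset (Fin m)).filter (fun i => (Z i).isRight)).card ≤ k), w Z * ‖kernel 𝕜 V m Z‖ := by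
  rw [sum_filter]
  refine sum_congr rfl fun Z _ => ?_
  rw [kernel_spectatorTrunc]
  split_ifs
  · rfl
  · rw [norm_zero, mul_zero]

end Norms

end Literature.MathematicalPhysics.QuantumLattice

end
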